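/-
Copyright (c) 2026. All rights reserved.
Released under Apache 2.0 license as described in the file LICENSE.
Authors: abc-iut cell, prover seat abc-iut-L4-d2 (gen 9).
-/
import Literature.AnabelianGeometry.AbsoluteAnabelian.GaloisTheatersNumberFieldShadowFunctorial
import Literature.AnabelianGeometry.AbsoluteAnabelian.GaloisTheatersNumberFieldShadowRmk511
import Literature.AnabelianGeometry.AbsoluteAnabelian.PanalocalTheatersGeneric
import Literature.AnabelianGeometry.AbsoluteAnabelian.AbsTopI.ChainTransport
import HarnessLib

/-!
# [AbsTopIII] Def 5.1 (ii)–(iv) at the number-field shadow context: `Aut(Π)`-conjugacy on `V⊚(Π)` is an equivalence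
# relation; embeddings under conjugate archimedean elements

S. Mochizuki, *Topics in absolute anabelian geometry III* [MochizukiAbsTopIII2015], Def 5.1 (ii) p. 115 (gloss: `Aut(Π_X)`
acts naturally on the data functorially constructed from `Π_X`, in particular on `V⊚(Π_X)`), Def 5.1 (iii) p. 115 (morphisms
of `EA⊚`), Def 5.1 (iv) p. 116 (the set `V⊚(Π)/Aut(Π)` underlying the panalocalization), Def 5.1 (i) p. 113 (archimedean
valuations).

PROOF-ONLY bookkeeping for the panalocalization of `T`-pairs at the shadow (sequel:
`GaloisTheatersNumberFieldShadowPanalocalTPairsExists.lean`, F-3085), over abc-iut-L4-d2's context term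
`NumberFieldShadow.context F` (g6) and its functoriality (`conjugator_comp`, `conjugator_id`, `context_mapProVal_id/comp`):

* `isEAHom_iso_hom` — every isomorphism of extensions is a morphism of `EA⊚`; `conjugator_iso_inv` — `τ_{α⁻¹} = τ_α⁻¹`;
* `autRel_equivalence_context` — the relation `AutRel` ("`w = V⊚(α)(v)` for an `EA⊚`-automorphism `α` of `Π_E`") IS an
  equivalence relation at the shadow, so (`exists_iso_mapProVal_eq_of_toModAut_eq`) two local elements have the same class in
  `V⊚(Π_E)/Aut(Π_E)` iff ONE automorphism carries one to the other;
* `exists_ringEquiv_contextKappa_smul` — the complex embeddings chosen under archimedean `v` and `w = τ • v` correspond under `τ`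
  up to complex conjugation: `κ_w(τ x) = C(κ_v x)` for a field automorphism `C` of `ℂ` (identity or conjugation);
* `nonempty_continuousMulEquiv_ofClosedSubgroup_of_eq` — equal closed subgroups give isomorphic profinite groups.

HONEST LABEL: the ARITHMETIC SHADOW (`Δ = 1`, stub archimedean geometry), NOT print's `EA⊚` of hyperbolic orbicurves
(E-L4-13).  No `def`/`instance`/`structure`; nothing here bears on [IUTchIII] Cor. 3.12 or takes a side; typed ≠ proved.
-/

noncomputable section

open scoped Pointwise Topology
open CategoryTheory NumberField Field

namespace Literature.AnabelianGeometry.AbsoluteAnabelian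

/-! ### Isomorphisms of extensions lie in `EA⊚` -/

/-- **Every isomorphism of extensions is a morphism of `EA⊚`** (an open injection inducing `Δ₁ ≅ Δ₂`): bijective on `Π`,
and both it and its inverse map `Δ` into `Δ`. [cite: MochizukiAbsTopIII2015, Def 5.1 (iii) p.115] -/
theorem isEAHom_iso_hom {E₁ E₂ : FundamentalExtension.{0}} (e : E₁ ≅ E₂) : IsEAHom e.hom where
  bijOn_geom := by
    refine ⟨e.hom.mapsTo_geom, (AbsTopI.isoArith e).injective.injOn, fun y hy => ?_⟩
    refine ⟨e.inv.arith y, e.inv.mapsTo_geom hy, ?_⟩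
    exact AbsTopI.iso_hom_inv_arith e y
  injective := (AbsTopI.isoArith e).injective
  isOpen_range := by
    rw [show Set.range e.hom.arith = Set.univ from (AbsTopI.isoArith e).surjective.range_eq]
    exact isOpen_univ

namespace NumberFieldShadow

variable (F : Type) [Field F] [NumberField F]

/-! ### `Aut(Π)`-conjugacy on `V⊚(Π)` is an equivalence relation at the shadow -/

/-- The conjugator of the inverse of an `EA⊚`-isomorphism is the inverse conjugator (conjugators compose and the conjugator
of the identity is `1`). [cite: MochizukiAbsTopIII2015, Def 5.1 (iii) p.115] -/
theorem conjugator_iso_inv {E₁ E₂ : FundamentalExtension.{0}} (e : E₁ ≅ E₂) :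
    conjugator e.inv (isEAHom_iso_hom e.symm) = (conjugator e.hom (isEAHom_iso_hom e))⁻¹ := by
  have h := conjugator_comp e.hom e.inv (isEAHom_iso_hom e) (isEAHom_iso_hom e.symm)
    (by rw [e.hom_inv_id]; exact isEAHom_id E₁)
  have h1 : conjugator (e.hom ≫ e.inv) (by rw [e.hom_inv_id]; exact isEAHom_id E₁) = 1 := by
    have : ∀ (f : E₁ ⟶ E₁) (hf : IsEAHom f) (h0 : f = 𝟙 E₁), conjugator f hf = 1 := by
      rintro f hf rfl
      exact conjugator_id E₁
    exact this _ _ e.hom_inv_id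
  rw [h1] at h
  exact eq_inv_of_mul_eq_one_left h.symm

/-- **At an admissible `Π_E` of the shadow, `AutRel` is an equivalence relation**: `Aut_{EA⊚}(Π_E)` is a group acting on
`V⊚(Π_E)` through `V⊚(−)`, which at the shadow is functorial on the nose (`V⊚(𝟙) = id`, `V⊚(α ≫ β) = V⊚(β) ∘ V⊚(α)`).
[cite: MochizukiAbsTopIII2015, Def 5.1 (ii) p.115] -/
theorem autRel_equivalence_context (E : FundamentalExtension.{0}) : Equivalence ((context F).AutRel E) where
  refl v := ⟨Iso.refl E, isEAHom_id E, context_mapProVal_id F E v⟩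
  symm := by
    rintro v w ⟨α, hα, rfl⟩
    refine ⟨α.symm, isEAHom_iso_hom α.symm, ?_⟩
    letI := (NumberField.valuationProSet ℚ).action
    change conjugator α.inv (isEAHom_iso_hom α.symm) • conjugator α.hom hα •
      (show (NumberField.valuationProSet ℚ).carrier from v) = v
    rw [show hα = isEAHom_iso_hom α from rfl, conjugator_iso_inv, inv_smul_smul]
  trans := by
    rintro u v w ⟨α, hα, rfl⟩ ⟨β, hβ, rfl⟩
    refine ⟨α ≪≫ β, isEAHom_iso_hom (α ≪≫ β), ?_⟩
    change (context F).mapProVal (α.hom ≫ β.hom) _ u = _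
    rw [context_mapProVal_comp F α.hom β.hom hα hβ]

/-- **Two local elements with the same class in `V⊚(Π_E)/Aut(Π_E)` differ by ONE automorphism of `Π_E`** (at the shadow
context). [cite: MochizukiAbsTopIII2015, Def 5.1 (iv) p.116] -/
theorem exists_iso_mapProVal_eq_of_toModAut_eq {E : FundamentalExtension.{0}} {v w : ((context F).proVal E).carrier}
    (h : (context F).toModAut E v = (context F).toModAut E w) :
    ∃ (α : E ≅ E) (hα : IsEAHom α.hom), (context F).mapProVal α.hom hα v = w := by
  rw [GlobalAnabelianContext.toModAut_eq_iff] at h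
  exact ((autRel_equivalence_context F E).eqvGen_iff).mp h

/-! ### Archimedean bookkeeping: the embeddings under `v` and `τ • v` correspond under `τ` up to conjugation -/

/-- **The complex embeddings chosen under an archimedean `v` and under its translate `τ • v` correspond under `τ` up to
complex conjugation**: there is a field automorphism `C` of `ℂ` (the identity or complex conjugation) with
`κ_{τ•v}(τ · x) = C(κ_v(x))` for all `x ∈ ℚ̄` (infinite places are embeddings up to conjugation).
[cite: MochizukiAbsTopIII2015, Def 5.1 (i) p.113] -/
theorem exists_ringEquiv_contextKappa_smul {E₁ E₂ : FundamentalExtension.{0}} (τ : absoluteGaloisGroup ℚ)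
    (v : (contextProVal E₁).arc) (w' : (contextProVal E₂).arc)
    (hvw : (w'.1 : (NumberField.valuationProSet ℚ).carrier) =
      (letI := (NumberField.valuationProSet ℚ).action; τ • (show (NumberField.valuationProSet ℚ).carrier from v.1))) :
    ∃ C : ℂ ≃+* ℂ, ∀ x : AlgebraicClosure ℚ, contextKappa E₂ w' (τ • x) = C (contextKappa E₁ v x) := by
  letI := NumberFieldValuationProSet.archAction ℚ
  obtain ⟨w', hv⟩ := w'
  change w' = _ at hvw
  subst hvw
  let w : InfinitePlace (AlgebraicClosure ℚ) := contextArcPlace E₁ v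
  have hw₂ : contextArcPlace E₂ ⟨_, hv⟩ = τ • w := contextArcPlace_smul τ v hv
  let τA : AlgebraicClosure ℚ ≃ₐ[ℚ] AlgebraicClosure ℚ := absoluteGaloisGroup.toAlgEquiv ℚ τ
  have hmk : InfinitePlace.mk (τ • w).embedding =
      InfinitePlace.mk (w.embedding.comp (τA.symm : AlgebraicClosure ℚ →+* AlgebraicClosure ℚ)) := by
    rw [InfinitePlace.mk_embedding, ← InfinitePlace.smul_mk, InfinitePlace.mk_embedding]
    rfl
  have hκ₂ : ∀ x : AlgebraicClosure ℚ, contextKappa E₂ ⟨_, hv⟩ (τ • x) = (τ • w).embedding (τA x) := by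
    intro x
    change (contextArcPlace E₂ ⟨_, hv⟩).embedding (τA x) = _
    rw [hw₂]
  have hκ₁ : ∀ x : AlgebraicClosure ℚ, w.embedding x = contextKappa E₁ v x := fun _ => rfl
  have hsymm : ∀ x : AlgebraicClosure ℚ,
      ((τA.symm : AlgebraicClosure ℚ →+* AlgebraicClosure ℚ) (τA x)) = x := fun x => τA.symm_apply_apply x
  rcases InfinitePlace.mk_eq_iff.mp hmk with hφ | hφ
  · refine ⟨RingEquiv.refl ℂ, fun x => ?_⟩
    rw [hκ₂]
    have hx := congrArg (fun φ : AlgebraicClosure ℚ →+* ℂ => φ (τA x)) hφ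
    simp only [RingHom.coe_comp, Function.comp_apply] at hx
    rw [hsymm, hκ₁] at hx
    exact hx
  · refine ⟨Complex.conjAe.toRingEquiv, fun x => ?_⟩
    rw [hκ₂]
    have hx := congrArg (fun φ : AlgebraicClosure ℚ →+* ℂ => φ (τA x)) hφ
    simp only [RingHom.coe_comp, Function.comp_apply] at hx
    rw [hsymm, ComplexEmbedding.conjugate_coe_eq] at hx
    -- `conj ((τ • w).embedding (τ x)) = w.embedding x`
    have hx' := congrArg (starRingEnd ℂ) hx
    rw [Complex.conj_conj, hκ₁] at hx'
    rw [hx']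
    simp [Complex.conjAe_coe]


/-! ### Equal closed subgroups give isomorphic profinite groups -/

/-- Equal closed subgroups of a profinite group define isomorphic profinite groups (bookkeeping for the decomposition
groups `Π_v = Π_{ψ_V(v)}` along a reference isomorphism). [cite: MochizukiAbsTopIII2015, Def 5.1 (iii) p.115] -/
theorem nonempty_continuousMulEquiv_ofClosedSubgroup_of_eq {G : ProfiniteGrp.{0}} {H K : Subgroup G}
    (hH : IsClosed (H : Set G)) (hK : IsClosed (K : Set G)) (h : H = K) :
    Nonempty (ProfiniteGrp.ofClosedSubgroup ⟨H, hH⟩ ≃ₜ* ProfiniteGrp.ofClosedSubgroup ⟨K, hK⟩) := by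
  subst h
  exact ⟨ContinuousMulEquiv.refl _⟩

end NumberFieldShadow

end Literature.AnabelianGeometry.AbsoluteAnabelian

end
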